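import Summits.QuantumFields.BalabanUV.T4Continuum.Support.NE3StraightAverageAdjoint
import Summits.QuantumFields.BalabanUV.T4Continuum.Support.NE3BlockPoincareCore
import Summits.QuantumFields.BalabanUV.T4Continuum.Support.NE3CovariantCalculus
import HarnessLib

/-!
# T⁴ programme, node NE3 — route H♮ (ruling ρ-g22-2), row K4, file K4-a: THE COVARIANT BLOCK-LINE SUM OVER AN ABSTRACT
# TRANSPORT FAMILY, ITS TORUS ADJOINT, AND THE EXACT ADJOINT IDENTITY AT ANY UNITARY BACKGROUND —
# `Σ_z Σ_κ hsR (ω z κ) (TWg M g η z κ) = Σ_x Σ_κ hsR (WadWg M g ω x κ) (η x κ)` (no gauge fixing, no smallness)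

NE3 formalisation swarm `b2b-balaban-t4-ne3-formalise-*`, LEAF PROVER 03 (unit `b2b-balaban-t4-ne3-formalise-leaf-03`, gen 7; cell
`pub-balaban`); row **K4** of the owner's ruling ρ-g22-2 (journal l.17514, «K4 → OWNER + leaf-03-g7») and SHAPE K4 (l.17848) item
**K4-a** «data + exact, ANY unitary W»; CLAIM journal l.17979.  The flat objects are (69S) `NE3StraightAverageAdjoint` (`Wad`,
`sum_inner_lineSum_eq_sum_inner_Wad`).

DESIGN.  The curved block-line sum transports each copy `η (M•z + v + i•e_κ) κ` to the block corner `M•z`.  Rather than fixing the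
comb path here, this file works over an ABSTRACT TRANSPORT FAMILY `g : Site d → Fin d → Site d → ℕ → (Matrix n n ℂ)ˣ` — corner `z`,
direction `κ`, offset `v ∈ [0,M)^d`, step `i < M` ↦ the transporter of that copy — so that the adjoint identity is a statement of
RE-INDEXING + `Ad`-invariance of the real Hilbert–Schmidt form `hsR` (leaf-03-g6 `NE3CovariantCalculus`), valid for EVERY family of
unitaries; all geometry (which paths) and all smallness (path defects) are deferred to K4-b ∕ the instance.  The adjoint is written in
the «which copies pass through `x`» form: the copy with step `i` passing through `x` starts at `x − i•e_κ`, i.e. in the block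
`cdiv M (x − i•e_κ)` at offset `cmod M (x − i•e_κ)`.

CONTENT (all [folklore]; 0 sorry; 0 `def … : Prop`; DATA defs `TWg`, `WadWg`, `klastWord`, `combTransport`, `TW`):
§1 `TWg M g η z κ := Σ_{v∈periodBox M} Σ_{i<M} Ad (g z κ v i)⁻¹ (η (M•z + v + i•e_κ) κ)`,
   `WadWg M g ω x κ := Σ_{i<M} Ad (g (cdiv M (x − i•e_κ)) κ (cmod M (x − i•e_κ)) i) (ω (cdiv M (x − i•e_κ)) κ)`;
§2 **`sum_hsR_copy_eq`** (one copy index: block tiling + torus shift + `hsR_Ad_left`) and **THE TORUS ADJOINT IDENTITY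
   `sum_hsR_TWg_eq_sum_hsR_WadWg`** for unitary, `N`-periodic-in-`z` `g`, `N`-periodic `ω`, `(M·N)`-periodic `η` — EXACT at any background;
§3 the residues of the copies through `x` (`cdiv_sub_smul_e_of_le` ∕ `cmod_sub_smul_e_of_le` for `i ≤ r_κ(x)`, `…_of_lt` for
   `r_κ(x) < i < M`) and the CLOSED FORM **`WadWg_eq`**: `(r_κ+1)` transported copies of `ω (cdiv M x) κ` + `(M−1−r_κ)` transported
   copies of `ω (cdiv M x − e_κ) κ`; at `g ≡ 1` this is (69S)'s `Wad` (`WadWg_one`);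
§4 THE `κ`-LAST COMB INSTANCE: `klastWord κ v i := treeWord (v − (v κ)•e_κ) ++ seg κ (v κ + i)` (transverse tree at the corner, THEN the
   `κ`-line — so that consecutive copies on a line differ by ONE bond: **`combTransport_succ`**
   `combTransport W M z κ v (i+1) = combTransport W M z κ v i * W (M•z + v + i•e_κ) κ`, pure word algebra), unitarity, `N`-periodicity in
   `z` for `(M·N)`-periodic `W`, and `TW L k W := TWg (L^k) (combTransport W (L^k))` — the single-scale comb line sum of the SHAPE, with
   its adjoint identity **`sum_hsR_TW_eq`** BY NAME.
(The covariant 1D summation by parts at any unitary periodic `V` is ALREADY in the tree: `NE3CovariantCalculus.sum_hsR_cD`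
(`cD V μ f x = Ad_{V(x,μ)} f(x+e_μ) − f x` against `cDstar`); (70S) `sum_inner_fd_eq_neg` is its `V = 1` case.  K4-b (the split
`WadW = D^W_κ hspW + JmpW (+ RemW)` with the face mismatches) rides on §3–§4.)

HONEST FRAMING.  Exact lattice bookkeeping at a GENERAL unitary background on OUR typed objects; no estimate; nothing about
Bałaban's minimisers; (P♮)_W, (ML_w) at W ≠ 1, T-E_w and NE3 are NOT proved; spine PROVED 0∕9; finite T⁴ rung (B)+1 — NOT infinite
volume, NOT mass gap, NOT BetaPertH, NOT Clay.  ABSOLUTE RULE kept (nothing printed is a hypothesis; context only: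
[Balaban1985Averaging] (27) p. 22, (42) p. 23, p. 24).  PLACEMENT: `Summits/QuantumFields/BalabanUV/`; imports accepted modules only
((69S), leaf-04's `NE3BlockPoincareCore`, leaf-03-g6's `NE3CovariantCalculus`).
-/

set_option autoImplicit false

open scoped BigOperators Matrix.Norms.L2Operator
open Finset

namespace Summit.QuantumFields.BalabanUV.T4Continuum.NE3CovariantLineAdjoint

open Literature.MathematicalPhysics.QuantumFieldTheory.Balaban1983to89
open B7Prop1Explicit B7Prop2Explicit
open T4AveragingDeficitWall (IsUnitaryCfg Ad)
open T4AveragingDeficitWallBoundary (periodBox mem_periodBox IsPeriodicCfg)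
open T4AveragingDeficitNonAbelian (Ad_mul hol_add_period)
open AveragingDeficitNearIdentity (Ad_one)
open NE3StraightAverageAdjoint (Wad cdiv_cmod_block)
open NE3BlockPoincareCore (sum_rotate3' sum_blocks_torus_shift)
open NE3CovariantCalculus (hsR hsR_sum_left hsR_sum_right hsR_Ad_left)
open SkeletonLattice (cdiv cmod smul_cdiv_add_cmod cmod_nonneg cmod_lt cdiv_eq_of_repr cmod_eq_of_repr cdiv_add_period
  cmod_add_period)

noncomputable section

variable {d : ℕ} {n : Type*} [Fintype n] [DecidableEq n]

/-! ## §1 The line sum over an abstract transport family and its adjoint -/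

/-- THE COVARIANT UNNORMALISED BLOCK-LINE SUM over the transport family `g`: every copy `η (M•z + v + i•e_κ) κ` is brought to the
corner frame by `Ad (g z κ v i)⁻¹` and summed (`v ∈ [0,M)^d`, `i < M`).  At `g ≡ 1` the flat line sum of (69S)∕(71S). [folklore] -/
def TWg (M : ℕ) (g : Site d → Fin d → Site d → ℕ → (Matrix n n ℂ)ˣ) (η : Site d → Fin d → Matrix n n ℂ) (z : Site d) (κ : Fin d) :
    Matrix n n ℂ :=
  ∑ v ∈ periodBox (d := d) M, ∑ i ∈ range M, Ad (g z κ v i)⁻¹ (η ((M : ℤ) • z + v + (i : ℤ) • e κ) κ)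

/-- THE TORUS ADJOINT of `TWg` read on the fine lattice, «which copies pass through `x`»: the copy with step `i` through `x` started
at `x − i•e_κ`, in the block `cdiv M (x − i•e_κ)` at offset `cmod M (x − i•e_κ)`; its coarse value is transported FORWARD by
`Ad (g …)`. [folklore] -/
def WadWg (M : ℕ) (g : Site d → Fin d → Site d → ℕ → (Matrix n n ℂ)ˣ) (ω : Site d → Fin d → Matrix n n ℂ) (x : Site d) (κ : Fin d) :
    Matrix n n ℂ :=
  ∑ i ∈ range M, Ad (g (cdiv M (x - (i : ℤ) • e κ)) κ (cmod M (x - (i : ℤ) • e κ)) i) (ω (cdiv M (x - (i : ℤ) • e κ)) κ)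

/-! ## §2 The exact adjoint identity at any unitary transport family -/

section Adjoint

variable {M N : ℕ}

/-- **ONE COPY INDEX**: for unitary `g` that is `N`-periodic in the corner, `N`-periodic `ω` and `(M·N)`-periodic `η`,
`Σ_{z∈periodBox N} Σ_{v∈[0,M)^d} hsR (ω z κ) (Ad (g z κ v i)⁻¹ (η (M•z+v+i•e_κ) κ))
 = Σ_{x∈periodBox (M·N)} hsR (Ad (g (cdiv M (x−i•e_κ)) κ (cmod M (x−i•e_κ)) i) (ω (cdiv M (x−i•e_κ)) κ)) (η x κ)`
(block tiling, torus shift by `i•e_κ`, `hsR_Ad_left`). [folklore] -/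
theorem sum_hsR_copy_eq (hM : 1 ≤ M) (hN : 1 ≤ N) (g : Site d → Fin d → Site d → ℕ → (Matrix n n ℂ)ˣ)
    (hg : ∀ z κ v i, g z κ v i ∈ unitaryUnits (Matrix n n ℂ))
    (hgP : ∀ (z : Site d) (τ κ : Fin d) (v : Site d) (i : ℕ), g (z + (N : ℤ) • e τ) κ v i = g z κ v i)
    (ω η : Site d → Fin d → Matrix n n ℂ) (hω : ∀ (z : Site d) (τ μ : Fin d), ω (z + (N : ℤ) • e τ) μ = ω z μ)
    (hη : ∀ (x : Site d) (τ μ : Fin d), η (x + ((M * N : ℕ) : ℤ) • e τ) μ = η x μ) (κ : Fin d) (i : ℕ) :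
    ∑ z ∈ periodBox (d := d) N, ∑ v ∈ periodBox (d := d) M,
        hsR (ω z κ) (Ad (g z κ v i)⁻¹ (η ((M : ℤ) • z + v + (i : ℤ) • e κ) κ))
      = ∑ x ∈ periodBox (d := d) (M * N),
        hsR (Ad (g (cdiv M (x - (i : ℤ) • e κ)) κ (cmod M (x - (i : ℤ) • e κ)) i) (ω (cdiv M (x - (i : ℤ) • e κ)) κ)) (η x κ) := by
  set G : Site d → ℝ := fun x =>
    hsR (Ad (g (cdiv M (x - (i : ℤ) • e κ)) κ (cmod M (x - (i : ℤ) • e κ)) i) (ω (cdiv M (x - (i : ℤ) • e κ)) κ)) (η x κ) with hGdef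
  have hGper : ∀ (x : Site d) (τ : Fin d), G (x + ((M * N : ℕ) : ℤ) • e τ) = G x := by
    intro x τ
    have hx : x + ((M * N : ℕ) : ℤ) • e τ - (i : ℤ) • e κ = (x - (i : ℤ) • e κ) + ((M : ℤ) * (N : ℤ)) • e τ := by
      push_cast; abel
    have hc := cdiv_add_period (L := M) hM (N : ℤ) (x - (i : ℤ) • e κ) τ
    have hm := cmod_add_period (L := M) (N : ℤ) (x - (i : ℤ) • e κ) τ
    simp only [hGdef]
    rw [hx, hc, hm, hgP, hω, hη]
  have hblock : ∀ (z v : Site d), v ∈ periodBox (d := d) M →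
      hsR (ω z κ) (Ad (g z κ v i)⁻¹ (η ((M : ℤ) • z + v + (i : ℤ) • e κ) κ)) = G ((M : ℤ) • z + v + (i : ℤ) • e κ) := by
    intro z v hv
    obtain ⟨h1, h2⟩ := cdiv_cmod_block (M := M) (z := z) hv
    simp only [hGdef, add_sub_cancel_right, h1, h2]
    exact (hsR_Ad_left (hg z κ v i) _ _).symm
  rw [← sum_blocks_torus_shift hM hN hGper ((i : ℤ) • e κ)]
  exact sum_congr rfl fun z _ => sum_congr rfl fun v hv => hblock z v hv

/-- **THE TORUS ADJOINT IDENTITY AT ANY UNITARY TRANSPORT FAMILY**: for unitary `g` `N`-periodic in the corner, `N`-periodic coarse `ω`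
and `(M·N)`-periodic fine `η` (`M, N ≥ 1`),
`Σ_{z∈periodBox N} Σ_κ hsR (ω z κ) (TWg M g η z κ) = Σ_{x∈periodBox (M·N)} Σ_κ hsR (WadWg M g ω x κ) (η x κ)` — EXACT: no gauge fixing,
no smallness, no comb geometry ((69S) `sum_inner_lineSum_eq_sum_inner_Wad` is the case `g ≡ 1`). [folklore] -/
theorem sum_hsR_TWg_eq_sum_hsR_WadWg (hM : 1 ≤ M) (hN : 1 ≤ N) (g : Site d → Fin d → Site d → ℕ → (Matrix n n ℂ)ˣ)
    (hg : ∀ z κ v i, g z κ v i ∈ unitaryUnits (Matrix n n ℂ))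
    (hgP : ∀ (z : Site d) (τ κ : Fin d) (v : Site d) (i : ℕ), g (z + (N : ℤ) • e τ) κ v i = g z κ v i)
    (ω η : Site d → Fin d → Matrix n n ℂ) (hω : ∀ (z : Site d) (τ μ : Fin d), ω (z + (N : ℤ) • e τ) μ = ω z μ)
    (hη : ∀ (x : Site d) (τ μ : Fin d), η (x + ((M * N : ℕ) : ℤ) • e τ) μ = η x μ) :
    ∑ z ∈ periodBox (d := d) N, ∑ κ : Fin d, hsR (ω z κ) (TWg M g η z κ)
      = ∑ x ∈ periodBox (d := d) (M * N), ∑ κ : Fin d, hsR (WadWg M g ω x κ) (η x κ) := by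
  -- left: distribute `hsR` and bring the copy index outermost
  have hL : ∀ κ : Fin d, ∑ z ∈ periodBox (d := d) N, hsR (ω z κ) (TWg M g η z κ)
      = ∑ i ∈ range M, ∑ z ∈ periodBox (d := d) N, ∑ v ∈ periodBox (d := d) M,
          hsR (ω z κ) (Ad (g z κ v i)⁻¹ (η ((M : ℤ) • z + v + (i : ℤ) • e κ) κ)) := by
    intro κ
    have h1 : ∀ z : Site d, hsR (ω z κ) (TWg M g η z κ)
        = ∑ v ∈ periodBox (d := d) M, ∑ i ∈ range M, hsR (ω z κ) (Ad (g z κ v i)⁻¹ (η ((M : ℤ) • z + v + (i : ℤ) • e κ) κ)) := by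
      intro z
      unfold TWg
      rw [hsR_sum_right]
      exact sum_congr rfl fun v _ => hsR_sum_right _ _ _
    rw [sum_congr rfl fun z _ => h1 z]
    rw [sum_rotate3' (periodBox (d := d) N) (periodBox (d := d) M) (range M)
      (fun z v i => hsR (ω z κ) (Ad (g z κ v i)⁻¹ (η ((M : ℤ) • z + v + (i : ℤ) • e κ) κ))),
      sum_rotate3' (periodBox (d := d) M) (range M) (periodBox (d := d) N)
      (fun v i z => hsR (ω z κ) (Ad (g z κ v i)⁻¹ (η ((M : ℤ) • z + v + (i : ℤ) • e κ) κ)))]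
  -- right: distribute `hsR` and bring the copy index outermost
  have hR : ∀ κ : Fin d, ∑ x ∈ periodBox (d := d) (M * N), hsR (WadWg M g ω x κ) (η x κ)
      = ∑ i ∈ range M, ∑ x ∈ periodBox (d := d) (M * N),
          hsR (Ad (g (cdiv M (x - (i : ℤ) • e κ)) κ (cmod M (x - (i : ℤ) • e κ)) i) (ω (cdiv M (x - (i : ℤ) • e κ)) κ)) (η x κ) := by
    intro κ
    have h1 : ∀ x : Site d, hsR (WadWg M g ω x κ) (η x κ) = ∑ i ∈ range M,
        hsR (Ad (g (cdiv M (x - (i : ℤ) • e κ)) κ (cmod M (x - (i : ℤ) • e κ)) i) (ω (cdiv M (x - (i : ℤ) • e κ)) κ)) (η x κ) := by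
      intro x
      unfold WadWg
      rw [hsR_sum_left]
    rw [sum_congr rfl fun x _ => h1 x, sum_comm]
  calc ∑ z ∈ periodBox (d := d) N, ∑ κ : Fin d, hsR (ω z κ) (TWg M g η z κ)
      = ∑ κ : Fin d, ∑ z ∈ periodBox (d := d) N, hsR (ω z κ) (TWg M g η z κ) := sum_comm
    _ = ∑ κ : Fin d, ∑ i ∈ range M, ∑ x ∈ periodBox (d := d) (M * N),
          hsR (Ad (g (cdiv M (x - (i : ℤ) • e κ)) κ (cmod M (x - (i : ℤ) • e κ)) i) (ω (cdiv M (x - (i : ℤ) • e κ)) κ)) (η x κ) := by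
        refine sum_congr rfl fun κ _ => ?_
        rw [hL κ]
        exact sum_congr rfl fun i _ => sum_hsR_copy_eq hM hN g hg hgP ω η hω hη κ i
    _ = ∑ κ : Fin d, ∑ x ∈ periodBox (d := d) (M * N), hsR (WadWg M g ω x κ) (η x κ) :=
        sum_congr rfl fun κ _ => (hR κ).symm
    _ = ∑ x ∈ periodBox (d := d) (M * N), ∑ κ : Fin d, hsR (WadWg M g ω x κ) (η x κ) := sum_comm

end Adjoint

/-! ## §3 The copies through a fine bond: residues and the closed form of the adjoint -/

section Residues

variable {M : ℕ}

omit [Fintype n] [DecidableEq n] in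
/-- A copy with step `i ≤ r_κ(x)` through `x` started in the SAME block: `cdiv M (x − i•e_κ) = cdiv M x`. [folklore] -/
theorem cdiv_sub_smul_e_of_le (hM : 1 ≤ M) {x : Site d} {κ : Fin d} {i : ℕ} (hi : (i : ℤ) ≤ cmod M x κ) :
    cdiv M (x - (i : ℤ) • e κ) = cdiv M x := by
  have hr0 := cmod_nonneg (L := M) hM x
  have hrL := cmod_lt (L := M) hM x
  refine cdiv_eq_of_repr (L := M) (q := cmod M x - (i : ℤ) • e κ) ?_ (fun j => ?_) (fun j => ?_)
  · conv_lhs => rw [← smul_cdiv_add_cmod M x]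
    abel
  · by_cases hj : j = κ
    · subst hj; simp only [Pi.sub_apply, Pi.smul_apply, e_apply, if_true, smul_eq_mul, mul_one]; omega
    · have := hr0 j; simp only [Pi.sub_apply, Pi.smul_apply, e_apply, if_neg hj, smul_eq_mul, mul_zero, sub_zero]; exact this
  · by_cases hj : j = κ
    · subst hj; have h1 := hrL j; simp only [Pi.sub_apply, Pi.smul_apply, e_apply, if_true, smul_eq_mul, mul_one]; omega
    · have := hrL j; simp only [Pi.sub_apply, Pi.smul_apply, e_apply, if_neg hj, smul_eq_mul, mul_zero, sub_zero]; exact this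

omit [Fintype n] [DecidableEq n] in
/-- … and its offset is `cmod M x − i•e_κ`. [folklore] -/
theorem cmod_sub_smul_e_of_le (hM : 1 ≤ M) {x : Site d} {κ : Fin d} {i : ℕ} (hi : (i : ℤ) ≤ cmod M x κ) :
    cmod M (x - (i : ℤ) • e κ) = cmod M x - (i : ℤ) • e κ := by
  have hr0 := cmod_nonneg (L := M) hM x
  have hrL := cmod_lt (L := M) hM x
  refine cmod_eq_of_repr (L := M) (z := cdiv M x) ?_ (fun j => ?_) (fun j => ?_)
  · conv_lhs => rw [← smul_cdiv_add_cmod M x]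
    abel
  · by_cases hj : j = κ
    · subst hj; simp only [Pi.sub_apply, Pi.smul_apply, e_apply, if_true, smul_eq_mul, mul_one]; omega
    · have := hr0 j; simp only [Pi.sub_apply, Pi.smul_apply, e_apply, if_neg hj, smul_eq_mul, mul_zero, sub_zero]; exact this
  · by_cases hj : j = κ
    · subst hj; have h1 := hrL j; simp only [Pi.sub_apply, Pi.smul_apply, e_apply, if_true, smul_eq_mul, mul_one]; omega
    · have := hrL j; simp only [Pi.sub_apply, Pi.smul_apply, e_apply, if_neg hj, smul_eq_mul, mul_zero, sub_zero]; exact this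

omit [Fintype n] [DecidableEq n] in
/-- A copy with step `r_κ(x) < i < M` through `x` started in the PREVIOUS block along `κ`: `cdiv M (x − i•e_κ) = cdiv M x − e_κ`.
[folklore] -/
theorem cdiv_sub_smul_e_of_lt (hM : 1 ≤ M) {x : Site d} {κ : Fin d} {i : ℕ} (hi : cmod M x κ < (i : ℤ)) (hiM : i < M) :
    cdiv M (x - (i : ℤ) • e κ) = cdiv M x - e κ := by
  have hr0 := cmod_nonneg (L := M) hM x
  have hrL := cmod_lt (L := M) hM x
  refine cdiv_eq_of_repr (L := M) (q := cmod M x - (i : ℤ) • e κ + (M : ℤ) • e κ) ?_ (fun j => ?_) (fun j => ?_)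
  · conv_lhs => rw [← smul_cdiv_add_cmod M x]
    rw [smul_sub]
    abel
  · by_cases hj : j = κ
    · subst hj; have h0 := hr0 j; have hiM' : (i : ℤ) < (M : ℤ) := by exact_mod_cast hiM
      simp only [Pi.add_apply, Pi.sub_apply, Pi.smul_apply, e_apply, if_true, smul_eq_mul, mul_one]; omega
    · have := hr0 j
      simp only [Pi.add_apply, Pi.sub_apply, Pi.smul_apply, e_apply, if_neg hj, smul_eq_mul, mul_zero, sub_zero, add_zero]; exact this
  · by_cases hj : j = κ
    · subst hj; have h1 := hrL j
      simp only [Pi.add_apply, Pi.sub_apply, Pi.smul_apply, e_apply, if_true, smul_eq_mul, mul_one]; omega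
    · have := hrL j
      simp only [Pi.add_apply, Pi.sub_apply, Pi.smul_apply, e_apply, if_neg hj, smul_eq_mul, mul_zero, sub_zero, add_zero]; exact this

omit [Fintype n] [DecidableEq n] in
/-- … and its offset is `cmod M x − i•e_κ + M•e_κ`. [folklore] -/
theorem cmod_sub_smul_e_of_lt (hM : 1 ≤ M) {x : Site d} {κ : Fin d} {i : ℕ} (hi : cmod M x κ < (i : ℤ)) (hiM : i < M) :
    cmod M (x - (i : ℤ) • e κ) = cmod M x - (i : ℤ) • e κ + (M : ℤ) • e κ := by
  have hr0 := cmod_nonneg (L := M) hM x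
  have hrL := cmod_lt (L := M) hM x
  refine cmod_eq_of_repr (L := M) (z := cdiv M x - e κ) ?_ (fun j => ?_) (fun j => ?_)
  · conv_lhs => rw [← smul_cdiv_add_cmod M x]
    rw [smul_sub]
    abel
  · by_cases hj : j = κ
    · subst hj; have h0 := hr0 j; have hiM' : (i : ℤ) < (M : ℤ) := by exact_mod_cast hiM
      simp only [Pi.add_apply, Pi.sub_apply, Pi.smul_apply, e_apply, if_true, smul_eq_mul, mul_one]; omega
    · have := hr0 j
      simp only [Pi.add_apply, Pi.sub_apply, Pi.smul_apply, e_apply, if_neg hj, smul_eq_mul, mul_zero, sub_zero, add_zero]; exact this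
  · by_cases hj : j = κ
    · subst hj; have h1 := hrL j
      simp only [Pi.add_apply, Pi.sub_apply, Pi.smul_apply, e_apply, if_true, smul_eq_mul, mul_one]; omega
    · have := hrL j
      simp only [Pi.add_apply, Pi.sub_apply, Pi.smul_apply, e_apply, if_neg hj, smul_eq_mul, mul_zero, sub_zero, add_zero]; exact this

/-- **THE CLOSED FORM OF THE ADJOINT**: with `z = cdiv M x`, `r = cmod M x`, the copies through `x` are the `r_κ + 1` copies of
`ω z κ` started in the block of `z` (steps `i ≤ r_κ`) and the `M − 1 − r_κ` copies of `ω (z − e_κ) κ` started in the previous block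
(steps `r_κ < i < M`), each with ITS transport:
`WadWg M g ω x κ = Σ_{i<M, i ≤ r_κ} Ad (g z κ (r − i•e_κ) i) (ω z κ) + Σ_{i<M, r_κ<i} Ad (g (z−e_κ) κ (r − i•e_κ + M•e_κ) i) (ω (z−e_κ) κ)`. [folklore] -/
theorem WadWg_eq (hM : 1 ≤ M) (g : Site d → Fin d → Site d → ℕ → (Matrix n n ℂ)ˣ) (ω : Site d → Fin d → Matrix n n ℂ)
    (x : Site d) (κ : Fin d) :
    WadWg M g ω x κ
      = ∑ i ∈ (range M).filter (fun i : ℕ => (i : ℤ) ≤ cmod M x κ),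
          Ad (g (cdiv M x) κ (cmod M x - (i : ℤ) • e κ) i) (ω (cdiv M x) κ)
        + ∑ i ∈ (range M).filter (fun i : ℕ => cmod M x κ < (i : ℤ)),
          Ad (g (cdiv M x - e κ) κ (cmod M x - (i : ℤ) • e κ + (M : ℤ) • e κ) i) (ω (cdiv M x - e κ) κ) := by
  unfold WadWg
  rw [← sum_filter_add_sum_filter_not (range M) (fun i : ℕ => (i : ℤ) ≤ cmod M x κ)]
  congr 1
  · refine sum_congr rfl fun i hi => ?_
    rw [mem_filter] at hi
    rw [cdiv_sub_smul_e_of_le hM hi.2, cmod_sub_smul_e_of_le hM hi.2]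
  · have hset : (range M).filter (fun i : ℕ => ¬((i : ℤ) ≤ cmod M x κ)) = (range M).filter (fun i : ℕ => cmod M x κ < (i : ℤ)) :=
      filter_congr fun i _ => not_le
    rw [hset]
    refine sum_congr rfl fun i hi => ?_
    rw [mem_filter, mem_range] at hi
    rw [cdiv_sub_smul_e_of_lt hM hi.2 hi.1, cmod_sub_smul_e_of_lt hM hi.2 hi.1]

/-- The number of copies from the block of `x` is `r_κ + 1`. [folklore] -/
theorem card_filter_le_cmod (hM : 1 ≤ M) (x : Site d) (κ : Fin d) :
    (((range M).filter (fun i : ℕ => (i : ℤ) ≤ cmod M x κ)).card : ℝ) = ((cmod M x κ : ℤ) : ℝ) + 1 := by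
  have hr0 := cmod_nonneg (L := M) hM x κ
  have hrL := cmod_lt (L := M) hM x κ
  obtain ⟨r, hr⟩ := Int.eq_ofNat_of_zero_le hr0
  have hrM : r < M := by exact_mod_cast (hr ▸ hrL)
  have hset : (range M).filter (fun i : ℕ => (i : ℤ) ≤ cmod M x κ) = range (r + 1) := by
    ext i
    simp only [mem_filter, mem_range, hr, Nat.cast_le]
    omega
  rw [hset, card_range, hr]
  push_cast
  ring

/-- The number of copies from the previous block is `M − 1 − r_κ`. [folklore] -/
theorem card_filter_cmod_lt (hM : 1 ≤ M) (x : Site d) (κ : Fin d) :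
    (((range M).filter (fun i : ℕ => cmod M x κ < (i : ℤ))).card : ℝ) = (M : ℝ) - 1 - ((cmod M x κ : ℤ) : ℝ) := by
  have hr0 := cmod_nonneg (L := M) hM x κ
  have hrL := cmod_lt (L := M) hM x κ
  obtain ⟨r, hr⟩ := Int.eq_ofNat_of_zero_le hr0
  have hrM : r < M := by exact_mod_cast (hr ▸ hrL)
  have hset : (range M).filter (fun i : ℕ => cmod M x κ < (i : ℤ)) = Ico (r + 1) M := by
    ext i
    simp only [mem_filter, mem_range, mem_Ico, hr, Nat.cast_lt]
    omega
  rw [hset, Nat.card_Ico, hr, Nat.cast_sub (by omega : r + 1 ≤ M)]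
  push_cast
  ring

/-- **AT THE TRIVIAL TRANSPORT FAMILY THE ADJOINT IS (69S)'s `Wad`**: `WadWg M 1 ω x κ = Wad M ω x κ`. [folklore] -/
theorem WadWg_one (hM : 1 ≤ M) (ω : Site d → Fin d → Matrix n n ℂ) (x : Site d) (κ : Fin d) :
    WadWg M (fun _ _ _ _ => 1) ω x κ = Wad M ω x κ := by
  rw [WadWg_eq hM]
  simp only [Ad_one, sum_const, ← Nat.cast_smul_eq_nsmul ℝ]
  rw [card_filter_le_cmod hM, card_filter_cmod_lt hM]
  rfl

/-- At the trivial transport family the line sum is the flat unnormalised line sum. [folklore] -/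
theorem TWg_one (M : ℕ) (η : Site d → Fin d → Matrix n n ℂ) (z : Site d) (κ : Fin d) :
    TWg M (fun _ _ _ _ => 1) η z κ = ∑ v ∈ periodBox (d := d) M, ∑ i ∈ range M, η ((M : ℤ) • z + v + (i : ℤ) • e κ) κ := by
  unfold TWg
  simp only [inv_one, Ad_one]

end Residues

/-! ## §4 The `κ`-last comb instance: transverse tree at the corner, then the `κ`-line -/

section Comb

/-- THE `κ`-LAST COMB WORD to the copy at offset `v`, step `i`: the tree over the transverse part `v − (v κ)•e_κ`, then `v κ + i`
steps along `κ` (so that the copies on one `κ`-line share their transverse path). [folklore] -/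
def klastWord (κ : Fin d) (v : Site d) (i : ℕ) : List (Letter d) :=
  treeWord (v - v κ • e κ) ++ seg κ (v κ + (i : ℤ))

omit [Fintype n] [DecidableEq n] in
/-- The comb word ends at the copy: `disp (klastWord κ v i) = v + i•e_κ`. [folklore] -/
theorem disp_klastWord (κ : Fin d) (v : Site d) (i : ℕ) : disp (klastWord κ v i) = v + (i : ℤ) • e κ := by
  rw [klastWord, disp_append, disp_treeWord, disp_seg, add_smul]
  abel

/-- THE COMB TRANSPORT FAMILY of a fine configuration `W` at block side `M`: the holonomy of `W` from the corner `M•z` along the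
`κ`-last comb word. [folklore] -/
def combTransport (W : Site d → Fin d → (Matrix n n ℂ)ˣ) (M : ℕ) (z : Site d) (κ : Fin d) (v : Site d) (i : ℕ) : (Matrix n n ℂ)ˣ :=
  hol W ((M : ℤ) • z) (klastWord κ v i)

/-- **CONSECUTIVE COPIES ON A LINE DIFFER BY ONE BOND**: `combTransport W M z κ v (i+1) = combTransport W M z κ v i · W (M•z + v + i•e_κ) κ`
(pure word algebra — the `κ`-covariance that makes the covariant summation by parts along `κ` defect-free inside blocks). [folklore] -/
theorem combTransport_succ (W : Site d → Fin d → (Matrix n n ℂ)ˣ) (M : ℕ) (z : Site d) (κ : Fin d) (v : Site d) (i : ℕ) :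
    combTransport W M z κ v (i + 1) = combTransport W M z κ v i * W ((M : ℤ) • z + v + (i : ℤ) • e κ) κ := by
  unfold combTransport klastWord
  rw [hol_append, hol_append, disp_treeWord, show v κ + ((i + 1 : ℕ) : ℤ) = (v κ + (i : ℤ)) + 1 by push_cast; ring,
    hol_seg_succ, mul_assoc]
  congr 2
  have : (M : ℤ) • z + (v - v κ • e κ) + (v κ + (i : ℤ)) • e κ = (M : ℤ) • z + v + (i : ℤ) • e κ := by
    rw [add_smul]; abel
  rw [this]

/-- The comb transports of `U(N)` data are unitary. [folklore] -/
theorem combTransport_mem {W : Site d → Fin d → (Matrix n n ℂ)ˣ} (hW : IsUnitaryCfg W) (M : ℕ) (z : Site d) (κ : Fin d)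
    (v : Site d) (i : ℕ) : combTransport W M z κ v i ∈ unitaryUnits (Matrix n n ℂ) :=
  hol_mem_of hW _ _

/-- The comb transports of an `(M·N)`-periodic configuration are `N`-periodic in the corner. [folklore] -/
theorem combTransport_add_period {W : Site d → Fin d → (Matrix n n ℂ)ˣ} {M N : ℕ} (hW : IsPeriodicCfg W ((M * N : ℕ) : ℤ))
    (z : Site d) (τ κ : Fin d) (v : Site d) (i : ℕ) :
    combTransport W M (z + (N : ℤ) • e τ) κ v i = combTransport W M z κ v i := by
  unfold combTransport
  rw [smul_add, smul_smul, show ((M : ℤ) * (N : ℤ)) = ((M * N : ℕ) : ℤ) by push_cast; ring]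
  exact hol_add_period hW τ _ _

/-- **THE SINGLE-SCALE COMB LINE SUM OF THE SHAPE** (ruling ρ-g22-2 ∕ SHAPE K4): `TW L k W η := TWg (L^k) (combTransport W (L^k)) η`.
[folklore] -/
def TW (L k : ℕ) (W : Site d → Fin d → (Matrix n n ℂ)ˣ) (η : Site d → Fin d → Matrix n n ℂ) (z : Site d) (κ : Fin d) : Matrix n n ℂ :=
  TWg (L ^ k) (combTransport W (L ^ k)) η z κ

/-- `TW` unfolded. [folklore] -/
theorem TW_eq (L k : ℕ) (W : Site d → Fin d → (Matrix n n ℂ)ˣ) (η : Site d → Fin d → Matrix n n ℂ) (z : Site d) (κ : Fin d) :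
    TW L k W η z κ = ∑ v ∈ periodBox (d := d) (L ^ k), ∑ i ∈ range (L ^ k),
      Ad (combTransport W (L ^ k) z κ v i)⁻¹ (η (((L ^ k : ℕ) : ℤ) • z + v + (i : ℤ) • e κ) κ) := rfl

/-- **THE ADJOINT IDENTITY FOR THE COMB LINE SUM** (any unitary `(L^k·N)`-periodic `W`, `L, N ≥ 1`):
`Σ_z Σ_κ hsR (ω z κ) (TW L k W η z κ) = Σ_x Σ_κ hsR (WadWg (L^k) (combTransport W (L^k)) ω x κ) (η x κ)`. [folklore] -/
theorem sum_hsR_TW_eq {L k N : ℕ} (hL : 1 ≤ L) (hN : 1 ≤ N) {W : Site d → Fin d → (Matrix n n ℂ)ˣ} (hW : IsUnitaryCfg W)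
    (hWP : IsPeriodicCfg W ((L ^ k * N : ℕ) : ℤ)) (ω η : Site d → Fin d → Matrix n n ℂ)
    (hω : ∀ (z : Site d) (τ μ : Fin d), ω (z + (N : ℤ) • e τ) μ = ω z μ)
    (hη : ∀ (x : Site d) (τ μ : Fin d), η (x + ((L ^ k * N : ℕ) : ℤ) • e τ) μ = η x μ) :
    ∑ z ∈ periodBox (d := d) N, ∑ κ : Fin d, hsR (ω z κ) (TW L k W η z κ)
      = ∑ x ∈ periodBox (d := d) (L ^ k * N), ∑ κ : Fin d, hsR (WadWg (L ^ k) (combTransport W (L ^ k)) ω x κ) (η x κ) :=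
  sum_hsR_TWg_eq_sum_hsR_WadWg (Nat.one_le_pow _ _ hL) hN (combTransport W (L ^ k)) (fun z κ v i => combTransport_mem hW _ z κ v i)
    (fun z τ κ v i => combTransport_add_period hWP z τ κ v i) ω η hω hη

end Comb

end

end Summit.QuantumFields.BalabanUV.T4Continuum.NE3CovariantLineAdjoint
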